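import Summits.Ventures.QEC.Census.CertCover
import Summits.Ventures.QEC.Census.CertCheckBZBridge
import HarnessLib

/-!
# Cover reduction, part 2: syndrome transport through row tables and the coset equation
# (qec lane ε, director-qec R29; census/search-9/cover/README.md §2, §4 L-push)

Continues `Census/CertCover.lean`. For a two-sheeted cover `c : Cover2` of the QUBITS together with a two-sheeted
cover `cr : Cover2` of the ROWS of a check matrix (`H` upstairs, `Hq` downstairs; for the abelian two-block codes both
are the quotient map of the group by an element of order 2):
* `synBit n H r v` — the syndrome bit of the word `v` at row `r` (overlap parity); `synWd` packs them;
  `synEqOK n H v σ` — «`H v = σ`» as a Bool check; parity helpers `popc_xor_mod_two`, `synBit_xor`,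
  `synZero_xor_of_synEqOK` (two solutions of `H y = σ` differ by a kernel word);
* `pushRowsOK c cr H Hq` — the ROW TABLE: `P (H[r]) = Hq[ρ r]` for every row (`ρ = cr.Q`); with adjointness this is
  the syndrome transport `syn_r (P* y) = syn_{ρ r} (y)` (`synBit_pull`) and hence, through the fibre decomposition,
  ★ `synEqOK_ypart_of_synZero`: if `H v = 0` then `y := ypart v` solves `Hq y = σ(P v)` where
  `σ(u) := sigmaOf c cr H u = descend cr (synWd H (lift₀ u))` reads the syndrome of the sheet-0 lift on the sheet-0
  row of each row fibre;
* `pullRowsOK c cr Hq H` — `P* (Hq[r̄]) = H[r̄₀] ⊕ H[r̄₁]`: pull-backs of downstairs rows, and of every downstairs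
  row combination (`ofBits_pull_xorSel_mem`), are upstairs row combinations.
The coset-enumeration checker and its soundness (L-coset) are `Census/CertCoverCoset.lean`.

HONEST FRAMING: generic; no code, no distance; everything proved; `decide`-evaluable checks. No instances, no notation.
-/

namespace Summit.Ventures.QEC.Census

open Matrix Literature.InformationTheory.QuantumCodes

/-! ## Syndrome bits and words -/

/-- The syndrome bit of `v` at row `r` of `H`: the overlap parity `|H[r] ∩ v| mod 2` as a Bool. (definition) -/
def synBit (n : ℕ) (H : List ℕ) (r v : ℕ) : Bool := popc n (H.getD r 0 &&& v) % 2 == 1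

/-- The syndrome word: bit `r` = `synBit n H r v` for `r < |H|`. (definition) -/
def synWd (n : ℕ) (H : List ℕ) (v : ℕ) : ℕ := mkBits H.length fun r => synBit n H r v

/-- «`H v = σ`»: every syndrome bit of `v` equals the corresponding bit of `σ`. (definition) -/
def synEqOK (n : ℕ) (H : List ℕ) (v sigma : ℕ) : Bool :=
  (List.range H.length).all fun r => synBit n H r v == sigma.testBit r

/-- `synZero` is `synEqOK` with `σ = 0`. -/
theorem synEqOK_zero_iff (n : ℕ) (H : List ℕ) (v : ℕ) : synEqOK n H v 0 = true ↔ synZero n H v = true := by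
  simp only [synEqOK, synZero, synBit, List.all_eq_true, List.mem_range, Nat.zero_testBit, beq_iff_eq]
  constructor
  · intro h x hx
    obtain ⟨r, hr, rfl⟩ := List.getElem_of_mem hx
    have := h r hr
    simp only [List.getD_eq_getElem?_getD, List.getElem?_eq_getElem hr, Option.getD_some] at this
    rcases Nat.mod_two_eq_zero_or_one (popc n (H[r] &&& v)) with h0 | h1
    · exact h0
    · simp [h1] at this
  · intro h r hr
    have := h _ (List.getElem_mem hr)
    simp only [List.getD_eq_getElem?_getD, List.getElem?_eq_getElem hr, Option.getD_some, this]
    decide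


/-- Parity of a bit count is additive under XOR: `|a ⊕ b| ≡ |a| + |b| (mod 2)`. -/
theorem popc_xor_mod_two (n a b : ℕ) : popc n (a ^^^ b) % 2 = (popc n a + popc n b) % 2 := by
  rw [popc_eq_sum, popc_eq_sum, popc_eq_sum, ← Finset.sum_add_distrib, Finset.sum_nat_mod,
    Finset.sum_nat_mod (s := Finset.univ) (f := fun i : Fin n => (a.testBit i).toNat + (b.testBit i).toNat)]
  congr 1
  refine Finset.sum_congr rfl fun i _ => ?_
  rw [Nat.testBit_xor]
  cases a.testBit i <;> cases b.testBit i <;> rfl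

/-- Syndrome bits are additive: `syn_r (a ⊕ b) = syn_r a ⊕ syn_r b`. -/
theorem synBit_xor (n : ℕ) (H : List ℕ) (r a b : ℕ) :
    synBit n H r (a ^^^ b) = xor (synBit n H r a) (synBit n H r b) := by
  unfold synBit
  rw [Nat.and_xor_distrib_left]
  have h := popc_xor_mod_two n (H.getD r 0 &&& a) (H.getD r 0 &&& b)
  generalize popc n ((H.getD r 0 &&& a) ^^^ (H.getD r 0 &&& b)) = X at h ⊢
  generalize popc n (H.getD r 0 &&& a) = A at h ⊢
  generalize popc n (H.getD r 0 &&& b) = B at h ⊢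
  rcases Nat.mod_two_eq_zero_or_one A with hA | hA <;> rcases Nat.mod_two_eq_zero_or_one B with hB | hB <;>
    · rw [Nat.add_mod, hA, hB] at h
      rw [h, hA, hB]
      decide

/-- A zero syndrome has all syndrome bits `false`. -/
theorem synBit_of_synZero {n : ℕ} {H : List ℕ} {v : ℕ} (h : synZero n H v = true) {r : ℕ} (hr : r < H.length) :
    synBit n H r v = false := by
  simp only [synZero, List.all_eq_true, beq_iff_eq] at h
  have := h _ (List.getElem_mem hr)
  simp only [synBit, List.getD_eq_getElem?_getD, List.getElem?_eq_getElem hr, Option.getD_some, this]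
  decide

/-- Conversely, all syndrome bits `false` is a zero syndrome. -/
theorem synZero_of_synBit {n : ℕ} {H : List ℕ} {v : ℕ} (h : ∀ r, r < H.length → synBit n H r v = false) :
    synZero n H v = true := by
  simp only [synZero, List.all_eq_true, beq_iff_eq]
  intro x hx
  obtain ⟨r, hr, rfl⟩ := List.getElem_of_mem hx
  have := h r hr
  simp only [synBit, List.getD_eq_getElem?_getD, List.getElem?_eq_getElem hr, Option.getD_some] at this
  rcases Nat.mod_two_eq_zero_or_one (popc n (H[r] &&& v)) with h0 | h1
  · exact h0
  · simp [h1] at this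

/-- Two words with the same syndrome differ by a kernel word. -/
theorem synZero_xor_of_synEqOK {n : ℕ} {H : List ℕ} {y y' sigma : ℕ} (hy : synEqOK n H y sigma = true)
    (hy' : synEqOK n H y' sigma = true) : synZero n H (y ^^^ y') = true := by
  simp only [synEqOK, List.all_eq_true, List.mem_range, beq_iff_eq] at hy hy'
  refine synZero_of_synBit fun r hr => ?_
  rw [synBit_xor, hy r hr, hy' r hr, Bool.xor_self]

/-! ## Row tables: syndrome transport and descent -/

/-- ROW TABLE of a cover (README §1 «P(HX₂₈₈ row (a,b)) = HX₁₄₄ row (a, b mod 6)»): the row cover `cr` has `|H|`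
rows upstairs and `|Hq|` downstairs, and the push-forward of every row of `H` is the row of `Hq` it lies over.
(definition) -/
def pushRowsOK (c cr : Cover2) (H Hq : List ℕ) : Bool :=
  (cr.n == H.length) && (cr.nq == Hq.length) &&
    (List.range H.length).all fun r => c.push (H.getD r 0) == Hq.getD (cr.Q r) 0

/-- PULL TABLE: the pull-back of every row of `Hq` is the XOR of the two rows of `H` over it (so `P*` maps the row
space of `Hq` into the row space of `H`). (definition) -/
def pullRowsOK (c cr : Cover2) (Hq H : List ℕ) : Bool :=
  (cr.n == H.length) && (cr.nq == Hq.length) &&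
    (List.range Hq.length).all fun rb => c.pull (Hq.getD rb 0) == (H.getD (cr.F0 rb) 0 ^^^ H.getD (cr.F1 rb) 0)

/-- Descent of a row-word along the row cover: bit `r̄` of `descend cr h` = bit `cr.f0 r̄` of `h` (read each row
fibre on its sheet-0 row). (definition) -/
def descend (cr : Cover2) (h : ℕ) : ℕ := mkBits cr.nq fun rb => h.testBit (cr.F0 rb)

/-- The target syndrome of the coset problem of `u`: `σ(u) := descend (synWd H (lift₀ u))`. (definition) -/
def sigmaOf (c cr : Cover2) (H : List ℕ) (u : ℕ) : ℕ := descend cr (synWd c.n H (c.lift0 u))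


/-- A row of `H` (read with `getD`, junk `0` out of range) lies in the row space of `H`. -/
theorem ofBits_getD_mem_rowSpace (n : ℕ) (H : List ℕ) (r : ℕ) :
    ofBits n (H.getD r 0) ∈ rowSpace (rowMatrix n H) := by
  by_cases hr : r < H.length
  · rw [rowSpace_rowMatrix_eq_span]
    refine Submodule.subset_span ⟨⟨r, hr⟩, ?_⟩
    funext j
    simp [rowMatrix, List.getD_eq_getElem?_getD, List.getElem?_eq_getElem hr]
  · rw [List.getD_eq_getElem?_getD, List.getElem?_eq_none (Nat.not_lt.1 hr), Option.getD_none, ofBits_zero]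
    exact Submodule.zero_mem _

/-- `P* 0 = 0`. -/
theorem Cover2.pull_zero (c : Cover2) : c.pull 0 = 0 := by
  apply Nat.eq_of_testBit_eq; intro q
  rw [Nat.zero_testBit, Cover2.pull, testBit_mkBits]
  simp

/-- `P*` commutes with row selections: `P* (xorSel L m) = xorSel (L.map P*) m`. -/
theorem Cover2.pull_xorSel (c : Cover2) : ∀ (L : List ℕ) (m : ℕ), c.pull (xorSel L m) = xorSel (L.map c.pull) m
  | [], _ => by simp [xorSel, Cover2.pull_zero]
  | r :: rs, m => by
    rw [List.map_cons, xorSel, xorSel, c.pull_xor, Cover2.pull_xorSel c rs (m / 2)]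
    congr 1
    split <;> simp [Cover2.pull_zero]

/-- A selection of words each lying in a submodule lies in the submodule. -/
theorem ofBits_xorSel_mem_of_forall {n : ℕ} (S : Submodule (ZMod 2) (Fin n → ZMod 2)) :
    ∀ (L : List ℕ), (∀ x ∈ L, ofBits n x ∈ S) → ∀ m : ℕ, ofBits n (xorSel L m) ∈ S
  | [], _, _ => by rw [xorSel, ofBits_zero]; exact S.zero_mem
  | r :: rs, h, m => by
    rw [xorSel, ofBits_xor]
    refine S.add_mem ?_ (ofBits_xorSel_mem_of_forall S rs (fun x hx => h x (List.mem_cons_of_mem _ hx)) _)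
    split
    · exact h r (List.mem_cons_self)
    · rw [ofBits_zero]; exact S.zero_mem

/-- **Syndrome transport** (L-push): with the row table, the syndrome bit of a pull-back at row `r` is the syndrome
bit downstairs at the row `ρ r` under it: `syn_r (P* y) = syn_{ρ r} (y)` (adjointness + `P H[r] = Hq[ρ r]`). -/
theorem synBit_pull {c cr : Cover2} (hc : c.ok = true) {H Hq : List ℕ} (hrows : pushRowsOK c cr H Hq = true)
    {r : ℕ} (hr : r < H.length) (y : ℕ) : synBit c.n H r (c.pull y) = synBit c.nq Hq (cr.Q r) y := by
  simp only [pushRowsOK, Bool.and_eq_true, List.all_eq_true, List.mem_range, beq_iff_eq] at hrows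
  rw [synBit, synBit, Cover2.popc_and_pull_mod_two hc, hrows.2 r hr]

/-- **The coset equation** (README §2): if `H v = 0` upstairs then `y := ypart v` solves `Hq y = σ(P v)` downstairs —
for every small row `r̄`, `syn_{r̄}(y) = bit r̄ of σ(P v)`. (From `v = lift₀(Pv) ⊕ P*(y)`, the transport at the
sheet-0 row over `r̄`, and `ρ (f0 r̄) = r̄`.) -/
theorem synEqOK_ypart_of_synZero {c cr : Cover2} (hc : c.ok = true) (hcr : cr.ok = true) {H Hq : List ℕ}
    (hrows : pushRowsOK c cr H Hq = true) {v : ℕ} (hv : v < 2 ^ c.n) (hsyn : synZero c.n H v = true) :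
    synEqOK c.nq Hq (c.ypart v) (sigmaOf c cr H (c.push v)) = true := by
  have hlen : cr.n = H.length ∧ cr.nq = Hq.length := by
    simp only [pushRowsOK, Bool.and_eq_true, beq_iff_eq] at hrows
    exact ⟨hrows.1.1, hrows.1.2⟩
  simp only [synEqOK, List.all_eq_true, List.mem_range, beq_iff_eq]
  intro rb hrb
  have hrb' : rb < cr.nq := hlen.2 ▸ hrb
  have hr : cr.F0 rb < H.length := hlen.1 ▸ Cover2.F0_lt hcr hrb'
  rw [sigmaOf, descend, testBit_mkBits_of_lt _ hrb', synWd, testBit_mkBits_of_lt _ hr]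
  -- the syndrome bit of `v = lift₀ (P v) ⊕ P* (ypart v)` at the sheet-0 row over `rb` vanishes
  have h0 := synBit_of_synZero hsyn hr
  rw [← Cover2.decomp hc hv, synBit_xor, synBit_pull hc hrows hr, Cover2.Q_F0 hcr hrb'] at h0
  revert h0
  cases synBit c.n H (cr.F0 rb) (c.lift0 (c.push v)) <;> cases synBit c.nq Hq rb (c.ypart v) <;> simp

/-- Pull-backs of downstairs rows are upstairs row combinations: with the pull table, `P* (Hq[r̄])` lies in the row
space of `H` (as vectors). -/
theorem ofBits_pull_row_mem {c cr : Cover2} {Hq H : List ℕ} (hpull : pullRowsOK c cr Hq H = true) {rb : ℕ}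
    (hrb : rb < Hq.length) : ofBits c.n (c.pull (Hq.getD rb 0)) ∈ rowSpace (rowMatrix c.n H) := by
  simp only [pullRowsOK, Bool.and_eq_true, List.all_eq_true, List.mem_range, beq_iff_eq] at hpull
  rw [hpull.2 rb hrb, ofBits_xor]
  exact Submodule.add_mem _ (ofBits_getD_mem_rowSpace c.n H _) (ofBits_getD_mem_rowSpace c.n H _)

/-- Hence `P*` maps the row space of `Hq` into the row space of `H`: for every selection word `m`,
`P* (xorSel Hq m)` is an `H`-row combination. -/
theorem ofBits_pull_xorSel_mem {c cr : Cover2} {Hq H : List ℕ} (hpull : pullRowsOK c cr Hq H = true) (m : ℕ) :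
    ofBits c.n (c.pull (xorSel Hq m)) ∈ rowSpace (rowMatrix c.n H) := by
  rw [Cover2.pull_xorSel]
  refine ofBits_xorSel_mem_of_forall _ _ (fun x hx => ?_) m
  rw [List.mem_map] at hx
  obtain ⟨r, hr, rfl⟩ := hx
  obtain ⟨rb, hrb, rfl⟩ := List.getElem_of_mem hr
  have := ofBits_pull_row_mem hpull hrb
  rwa [List.getD_eq_getElem?_getD, List.getElem?_eq_getElem hrb, Option.getD_some] at this


end Summit.Ventures.QEC.Census
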